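import Mathlib
import Summits.MatrixMultiplication.MatrixMultiplication.Theorems.SoloInformedCwTwoMonomialDoor
import Summits.MatrixMultiplication.MatrixMultiplication.Theorems.SoloInformedCwTwoBorderSumFree

/-!
# Integer digit designs are cyclic designs: value weights, and `bR(T_{cw,2}^{⊠N}) ≤ σ + 1`

Solo-informed seat, door D6/D7. An INTEGER weighted digit design is a digit system
`F k : Fin 3 → ℕ` with weights `θ k : Fin 3 → ℕ` such that every solution IN `ℕ` of
`P(u) + P(v) + P(w) = σ := ∑ₖ (F k 0 + F k 1 + F k 2)` off `S_N` has total weight `> h₀(θ)`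
(`IsDoorDesign` over the group `ℤ`). Such a design realises `X^{⊠N}` as a monomial degeneration of
the truncated polynomial algebra `ℂ[x]/(x^{σ+1})`; this file shows that nothing is gained over the
group door: reducing the digits mod `σ + 1` and adding `K`-times the digit VALUE to its weight
(`a k j = θ k j + K · F k j`, `K = h₀(θ) + 1`) gives a weighted digit design in the cyclic group
`ℤ/(σ+1)` (`isDoorDesign_zmod_of_int`): a relation mod `σ+1` has integer sum `σ + m(σ+1)`;
`m = 0` is an integer relation (and `K·σ` cancels), while a wrap-around `m ≥ 1` carries value weight
`≥ K(2σ+1) > h₀(θ) + Kσ = h₀(a)`. Hence `bR(T_{cw,2}^{⊠N}) ≤ σ + 1`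
(`algBorderRank_kroneckerPow_cwTensor_two_le_sigma_succ`), and the integer census
(`σ_min(N) = 4^N − 1` for `N ≤ 3`, seat notes) is a sub-census of the cyclic-group census.

References: J. Alman, V. Vassilevska Williams, *Limits on all known (and some unknown) approaches to
matrix multiplication*, FOCS 2018, arXiv:1810.08671, Thm 7.2 (monomial degenerations of `T_{ℤ/m}`);
D. Coppersmith, S. Winograd, *Matrix multiplication via arithmetic progressions*, JSC 9 (1990), §6
(integer-valued "hash" digits).
-/

noncomputable section

open scoped BigOperators

namespace Summit.MatrixMultiplication.MatrixMultiplication.Theorems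

open Literature.Computability.AlgebraicComplexity

variable {N : ℕ}

/-- The cost `σ(F) = ∑ₖ (F k 0 + F k 1 + F k 2)` of an integer digit system. [folklore] -/
def digitSigma (F : Fin N → Fin 3 → ℕ) : ℕ := ∑ k, (F k 0 + F k 1 + F k 2)

/-- The common transversal weight `h₀(θ) = ∑ₖ (θ k 0 + θ k 1 + θ k 2)`. [folklore] -/
def weightTotal (θ : Fin N → Fin 3 → ℕ) : ℕ := ∑ k, (θ k 0 + θ k 1 + θ k 2)

/-- The VALUE WEIGHTS `a k j = θ k j + K · F k j`. [folklore] -/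
def valueWeights (F θ : Fin N → Fin 3 → ℕ) (K : ℕ) : Fin N → Fin 3 → ℕ :=
  fun k j => θ k j + K * F k j

/-- Word weight of the value weights: `wt_a(u) = wt_θ(u) + K · P_ℕ(u)`. [folklore] -/
theorem wordWt_valueWeights (F θ : Fin N → Fin 3 → ℕ) (K : ℕ) (u : Fin N → Fin 3) :
    wordWt (valueWeights F θ K) u = wordWt θ u + K * ∑ k, F k (u k) := by
  simp only [wordWt, valueWeights, Finset.sum_add_distrib, Finset.mul_sum]

/-- Total of the value weights: `h₀(a) = h₀(θ) + K · σ(F)`. [folklore] -/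
theorem weightTotal_valueWeights (F θ : Fin N → Fin 3 → ℕ) (K : ℕ) :
    ∑ k, (valueWeights F θ K k 0 + valueWeights F θ K k 1 + valueWeights F θ K k 2) =
      weightTotal θ + K * digitSigma F := by
  simp only [valueWeights, weightTotal, digitSigma, Finset.mul_sum, ← Finset.sum_add_distrib]
  refine Finset.sum_congr rfl fun k _ => ?_
  ring

/-- Word sums of cast digits are casts of the natural word sum. [folklore] -/
theorem wordSum_natCast {R : Type*} [AddCommGroupWithOne R] (F : Fin N → Fin 3 → ℕ)
    (u : Fin N → Fin 3) :
    wordSum (fun k j => (F k j : R)) u = ((∑ k, F k (u k) : ℕ) : R) := by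
  simp only [wordSum, Nat.cast_sum]

/-- The cost of cast digits is the cast of `σ(F)`. [folklore] -/
theorem sigma_natCast {R : Type*} [AddCommGroupWithOne R] (F : Fin N → Fin 3 → ℕ) :
    ∑ k, ((F k 0 : R) + (F k 1 : R) + (F k 2 : R)) = ((digitSigma F : ℕ) : R) := by
  simp only [digitSigma, Nat.cast_sum, Nat.cast_add]

/-- **Value weights: an integer weighted digit design is a cyclic one.** If `(F, θ)` is a weighted
digit design over `ℤ` (every integer relation `P(u)+P(v)+P(w) = σ` off `S_N` has weight `> h₀(θ)`),
then the digits mod `σ+1` with weights `θ + (h₀(θ)+1)·F` are a weighted digit design in `ℤ/(σ+1)`.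
[new; seat solo-informed, door D7 ⊆ D6] -/
theorem isDoorDesign_zmod_of_int (F θ : Fin N → Fin 3 → ℕ)
    (hdes : IsDoorDesign (fun k j => (F k j : ℤ)) θ) :
    IsDoorDesign (fun k j => (F k j : ZMod (digitSigma F + 1)))
      (valueWeights F θ (weightTotal θ + 1)) := by
  intro u v w hrel
  -- pass to natural word sums and to the value-weight totals first, then name everything
  rw [wordSum_natCast, wordSum_natCast, wordSum_natCast, sigma_natCast] at hrel
  rw [weightTotal_valueWeights, wordWt_valueWeights, wordWt_valueWeights, wordWt_valueWeights]
  set M := digitSigma F + 1 with hM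
  set K := weightTotal θ + 1 with hK
  set Su := ∑ k, F k (u k) with hSu
  set Sv := ∑ k, F k (v k) with hSv
  set Sw := ∑ k, F k (w k) with hSw
  -- the relation mod `M` says `Su + Sv + Sw ≡ σ (mod M)`
  have hmod : (Su + Sv + Sw) % M = digitSigma F % M := by
    rw [← ZMod.natCast_eq_natCast_iff']
    push_cast
    exact_mod_cast hrel
  have hσlt : digitSigma F % M = digitSigma F := Nat.mod_eq_of_lt (by omega)
  rw [hσlt] at hmod
  have hdecomp : Su + Sv + Sw = M * ((Su + Sv + Sw) / M) + digitSigma F := by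
    have := Nat.div_add_mod (Su + Sv + Sw) M
    omega
  rcases Nat.eq_zero_or_pos ((Su + Sv + Sw) / M) with hq | hq
  · -- no wrap-around: an integer relation
    rw [hq, mul_zero, zero_add] at hdecomp
    have hrelZ : wordSum (fun k j => (F k j : ℤ)) u + wordSum (fun k j => (F k j : ℤ)) v +
        wordSum (fun k j => (F k j : ℤ)) w = ∑ k, ((F k 0 : ℤ) + (F k 1 : ℤ) + (F k 2 : ℤ)) := by
      rw [wordSum_natCast, wordSum_natCast, wordSum_natCast, sigma_natCast]
      exact_mod_cast hdecomp
    rcases hdes u v w hrelZ with hS | hlt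
    · exact Or.inl hS
    · right
      have hKσ : K * Su + K * Sv + K * Sw = K * digitSigma F := by
        rw [← mul_add, ← mul_add, hdecomp]
      have hW : weightTotal θ = ∑ k, (θ k 0 + θ k 1 + θ k 2) := rfl
      omega
  · -- wrap-around: the value weight alone exceeds `h₀(a)`
    right
    have hge : M + digitSigma F ≤ Su + Sv + Sw := by
      have h1 : M * 1 ≤ M * ((Su + Sv + Sw) / M) := Nat.mul_le_mul_left M hq
      omega
    have hKS : K * (M + digitSigma F) ≤ K * Su + K * Sv + K * Sw := by
      rw [← mul_add, ← mul_add]; exact Nat.mul_le_mul_left K hge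
    have hKM : K * (M + digitSigma F) = K * M + K * digitSigma F := mul_add K M _
    have hK1 : K ≤ K * M := Nat.le_mul_of_pos_right K (by omega)
    omega

/-- **`bR(T_{cw,2}^{⊠N}) ≤ σ(F) + 1`** for every integer weighted digit design `(F, θ)` of `S_N`:
the truncated-polynomial / cyclic host `ℤ/(σ+1)`. [new; seat solo-informed, door D7 ⊆ D6] -/
theorem algBorderRank_kroneckerPow_cwTensor_two_le_sigma_succ (F θ : Fin N → Fin 3 → ℕ)
    (hdes : IsDoorDesign (fun k j => (F k j : ℤ)) θ) :
    algBorderRank (kroneckerPow (cwTensor ℂ 2) N) ≤ digitSigma F + 1 := by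
  have h := algBorderRank_kroneckerPow_cwTensor_two_le_card
    (B := ZMod (digitSigma F + 1)) (fun k j => (F k j : ZMod (digitSigma F + 1)))
    (valueWeights F θ (weightTotal θ + 1)) (isDoorDesign_zmod_of_int F θ hdes)
  simpa [ZMod.card] using h

/-! ## The smallest instance: base-4 digits `(0,1,2)`, weights `(0,1,0)`, `σ + 1 = 4` -/

/-- The CW/AVW digits `(0,1,2)` with weights `(0,1,0)` are an integer weighted design of `S_1`
(`1+1+1 = 3` is the only non-transversal relation, of weight `3 > 1`). [cite: AlmanVassilevskaWilliams2018, Thm. 7.2] -/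
theorem base4_int_design :
    IsDoorDesign (N := 1) (fun _ j => ((![0, 1, 2] : Fin 3 → ℕ) j : ℤ)) (fun _ => ![0, 1, 0]) := by
  intro u v w hrel
  simp only [wordSum, wordWt, Finset.univ_unique, Fin.default_eq_zero, Finset.sum_singleton,
    Fin.isValue] at hrel ⊢
  have key : ∀ a b c : Fin 3,
      (((![0, 1, 2] : Fin 3 → ℕ) a : ℤ)) + ((![0, 1, 2] : Fin 3 → ℕ) b : ℤ) +
          ((![0, 1, 2] : Fin 3 → ℕ) c : ℤ) =
        (((![0, 1, 2] : Fin 3 → ℕ) 0 : ℤ)) + ((![0, 1, 2] : Fin 3 → ℕ) 1 : ℤ) +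
          ((![0, 1, 2] : Fin 3 → ℕ) 2 : ℤ) →
      (a ≠ b ∧ a ≠ c ∧ b ≠ c) ∨
        (![0, 1, 0] : Fin 3 → ℕ) 0 + (![0, 1, 0] : Fin 3 → ℕ) 1 + (![0, 1, 0] : Fin 3 → ℕ) 2 <
          (![0, 1, 0] : Fin 3 → ℕ) a + (![0, 1, 0] : Fin 3 → ℕ) b + (![0, 1, 0] : Fin 3 → ℕ) c := by
    decide
  rcases key (u 0) (v 0) (w 0) hrel with h | h
  · exact Or.inl fun k => by rwa [Subsingleton.elim k 0]
  · exact Or.inr h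

/-- Hence `bR(T_{cw,2}) ≤ 4` recovered through the integer door (`σ + 1 = 0+1+2+1 = 4`). [cite: AlmanVassilevskaWilliams2018, Thm. 7.2] -/
theorem algBorderRank_cwTensor_two_pow_one_le_four :
    algBorderRank (kroneckerPow (cwTensor ℂ 2) 1) ≤ 4 := by
  have h := algBorderRank_kroneckerPow_cwTensor_two_le_sigma_succ _ _ base4_int_design
  simpa [digitSigma] using h

end Summit.MatrixMultiplication.MatrixMultiplication.Theorems
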